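import Summits.NavierStokesRegularity.NavierStokesRegularity.Theorems.SqueezeCycleExtremalBiaxialitySubcriticalGaugeStrainBound
import Summits.NavierStokesRegularity.NavierStokesRegularity.Theorems.ExtremalBiaxialitySubcritical.Negative.KinematicDecoyProfile
import Literature.Analysis.FluidPDE.LeraySelfSimilarCalculus
import HarnessLib

/-!
# Crux `ExtremalBiaxialitySubcritical`, negative side: the kinematic decoy, II — the field

Route `SqueezeCycle`, crux
`Summit.NavierStokesRegularity.NavierStokesRegularity.Theses.SqueezeCycle.ExtremalBiaxialitySubcritical`
(stmt-NavierStokesRegularity-11609). Extracted from the crux work file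
`Cruxes/ExtremalBiaxialitySubcritical/Disproof.lean` (cdisprove adversary, generation 4, D-0016).
Part II: the space-time field and its kinematic clauses (H1), (H2), (H4), the squeeze at `(−1,0)`, and
the class-maximality of large values.

* `decoy a δ t x = φ(t) · a · W(x/δ)` with `φ = decoyTime` a `ContDiffBump` in time, `≡ 1` near
  `t = −1`, supported in `(−3/2, −1/2)`, values in `[0,1]`: jointly smooth (`contDiffOn_uncurry_decoy`),
  divergence free (`isDivFree_decoy`), `∇u(t)(x) = φ(t) a δ⁻¹ DW(x/δ)` (`fderiv_decoy`);
* `decoy_lamGE`: the crux's LOWER two-frame clause with value `a/(2δ)` at `(−1, 0)`;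
* `hasTypeITimeDecay_decoy`: the Type-I rate (H4) with constant `C` as soon as `a · sup‖W‖ ≤ C/2`
  (`φ` lives where `√(−t) ≤ 2`);
* `exists_isClassMax_of_le`: by the class-uniform KNSS gauge gradient bound `(−t)‖∇v(t,x)‖ ≤ K₀(C)`
  on the Type-I KNSS-mild class (tree `exists_gauge_norm_fderiv_le_of_typeI`) every `m ≥ K₀(C)`
  satisfies the crux's class-maximality clause over `𝒦_C` verbatim (`upper_clause_of_gauge_norm_le`:
  `(−t)⟪∇v z, z⟫ ≤ (−t)‖∇v‖|z|²` on the frame `(e₀, e₁)`).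

References: Koch–Nadirashvili–Seregin–Šverák, Acta Math. 203 (2009) §4 Prop. 4.1 (gauge gradient bound).
-/

noncomputable section

open Set Function Filter MeasureTheory Metric
open scoped RealInnerProductSpace ContDiff Topology

namespace Summit.NavierStokesRegularity.NavierStokesRegularity.Theorems.ExtremalBiaxialitySubcritical.Negative

open Literature.Analysis.FluidPDE
open Summit.NavierStokesRegularity.NavierStokesRegularity.Theses

/-! ### The decoy field -/

/-- The time profile: a smooth bump `≡ 1` near `t = −1`, supported in `(−3/2, −1/2)`,
values in `[0, 1]`. [folklore] -/
def decoyTime : ContDiffBump (-1 : ℝ) := ⟨1 / 4, 1 / 2, by norm_num, by norm_num⟩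

/-- `φ(−1) = 1`. [folklore] -/
theorem decoyTime_neg_one : decoyTime (-1) = 1 :=
  decoyTime.one_of_mem_closedBall (mem_closedBall_self decoyTime.rIn_pos.le)

/-- `φ(t) = 0` once `|t + 1| ≥ 1/2`. [folklore] -/
theorem decoyTime_eq_zero {t : ℝ} (ht : 1 / 2 ≤ |t + 1|) : decoyTime t = 0 := by
  apply decoyTime.zero_of_le_dist
  rw [Real.dist_eq, show t - -1 = t + 1 by ring]
  exact ht

/-- `0 ≤ φ ≤ 1`. [folklore] -/
theorem decoyTime_nonneg (t : ℝ) : 0 ≤ decoyTime t := decoyTime.nonneg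

/-- `φ ≤ 1`. [folklore] -/
theorem decoyTime_le_one (t : ℝ) : decoyTime t ≤ 1 := decoyTime.le_one

/-- `φ(t)² ≤ 𝟙_{[−3/2, −1/2]}(t)`. [folklore] -/
theorem decoyTime_sq_le_indicator (t : ℝ) :
    decoyTime t ^ 2 ≤ (Icc (-(3 / 2) : ℝ) (-(1 / 2))).indicator (fun _ => (1 : ℝ)) t := by
  by_cases ht : t ∈ Icc (-(3 / 2) : ℝ) (-(1 / 2))
  · rw [indicator_of_mem ht]
    have h1 := decoyTime_le_one t
    have h0 := decoyTime_nonneg t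
    nlinarith
  · rw [indicator_of_notMem ht]
    have hfar : 1 / 2 ≤ |t + 1| := by
      rw [mem_Icc, not_and_or, not_le, not_le] at ht
      rcases ht with h | h
      · rw [abs_of_neg (by linarith)]; linarith
      · rw [abs_of_pos (by linarith)]; linarith
    rw [decoyTime_eq_zero hfar]
    simp

/-- **The kinematic decoy** `u_{a,δ}(t, x) = φ(t) · a · W(x/δ)`. [folklore] -/
def decoy (a δ : ℝ) (t : ℝ) (x : EuclideanSpace ℝ (Fin 3)) : EuclideanSpace ℝ (Fin 3) :=
  (decoyTime t * a) • decoyProfile (δ⁻¹ • x)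

/-- The decoy is jointly smooth on all of space-time (in particular on `(−∞,0) × ℝ³`). [folklore] -/
theorem contDiffOn_uncurry_decoy (a δ : ℝ) :
    ContDiffOn ℝ (⊤ : ℕ∞) (Function.uncurry (decoy a δ)) (Set.Iio 0 ×ˢ Set.univ) := by
  have h : ContDiff ℝ ∞ (fun p : ℝ × EuclideanSpace ℝ (Fin 3) => (decoyTime p.1 * a) • decoyProfile (δ⁻¹ • p.2)) :=
    ((decoyTime.contDiff.comp contDiff_fst).mul contDiff_const).smul
      (contDiff_decoyProfile.comp (contDiff_snd.const_smul δ⁻¹))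
  exact h.contDiffOn

/-- The slices of the decoy are smooth. [folklore] -/
theorem contDiff_decoy_slice (a δ t : ℝ) : ContDiff ℝ ∞ (decoy a δ t) :=
  (contDiff_decoyProfile.comp (contDiff_id.const_smul δ⁻¹)).const_smul _

/-- `D u(t)(x) = (φ(t) a δ⁻¹) • DW(x/δ)`. [folklore] -/
theorem fderiv_decoy (a δ t : ℝ) (x : EuclideanSpace ℝ (Fin 3)) :
    fderiv ℝ (decoy a δ t) x = (decoyTime t * a * δ⁻¹) • fderiv ℝ decoyProfile (δ⁻¹ • x) :=
  fderiv_const_smul_comp_smul' decoyProfile (decoyTime t * a) δ⁻¹ x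

/-- `div u(t) = 0`. [folklore] -/
theorem isDivFree_decoy (a δ t : ℝ) : VectorCalculus.IsDivFree (decoy a δ t) := by
  intro x
  have h : VectorCalculus.divergence (decoy a δ t) x =
      (decoyTime t * a * δ⁻¹) * VectorCalculus.divergence decoyProfile (δ⁻¹ • x) := by
    simp only [VectorCalculus.divergence, fderiv_decoy, ContinuousLinearMap.toLinearMap_smul, map_smul,
      smul_eq_mul]
  rw [h, isDivFree_decoyProfile (δ⁻¹ • x), mul_zero]

/-- `D u(−1)(0) = (a/δ) • L`. [folklore] -/
theorem fderiv_decoy_negOne_zero (a δ : ℝ) :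
    fderiv ℝ (decoy a δ (-1)) 0 = (a * δ⁻¹) • decoyLin := by
  rw [fderiv_decoy, smul_zero, fderiv_decoyProfile_zero, decoyTime_neg_one, one_mul]

/-- **The decoy attains the crux's lower two-frame clause with value `a/(2δ)` at `(−1, 0)`**
(frame `(e₁, (e₀+e₂)/√2)`), for `a ≥ 0`, `δ > 0`. [folklore] -/
theorem decoy_lamGE {a δ : ℝ} (ha : 0 ≤ a) (hδ : 0 < δ) :
    ∃ v w : EuclideanSpace ℝ (Fin 3), ‖v‖ = 1 ∧ ‖w‖ = 1 ∧ inner ℝ v w = 0 ∧ ∀ α β : ℝ,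
      (a / (2 * δ)) * (α ^ 2 + β ^ 2) ≤
        (-(-1 : ℝ)) * inner ℝ (fderiv ℝ (decoy a δ (-1)) 0 (α • v + β • w)) (α • v + β • w) := by
  refine ⟨frameV, frameW, norm_frameV, norm_frameW, inner_frameV_frameW, fun α β => ?_⟩
  rw [fderiv_decoy_negOne_zero,
    show ((a * δ⁻¹) • decoyLin) (α • frameV + β • frameW) = (a * δ⁻¹) • decoyLin (α • frameV + β • frameW)
      from rfl,
    real_inner_smul_left, neg_neg, one_mul]
  have h := decoyLin_frame α β
  have hc : 0 ≤ a * δ⁻¹ := mul_nonneg ha (inv_nonneg.2 hδ.le)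
  calc a / (2 * δ) * (α ^ 2 + β ^ 2) = (a * δ⁻¹) * ((1 / 2 : ℝ) * (α ^ 2 + β ^ 2)) := by
        field_simp
    _ ≤ (a * δ⁻¹) * ⟪decoyLin (α • frameV + β • frameW), α • frameV + β • frameW⟫ :=
        mul_le_mul_of_nonneg_left h hc

/-! ### The Type-I rate -/

/-- `W` is bounded. [folklore] -/
theorem exists_bound_decoyProfile : ∃ M : ℝ, 0 < M ∧ ∀ y, ‖decoyProfile y‖ ≤ M := by
  obtain ⟨M, hM⟩ := continuous_decoyProfile.bounded_above_of_compact_support hasCompactSupport_decoyProfile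
  exact ⟨max M 1, by positivity, fun y => (hM y).trans (le_max_left _ _)⟩

/-- `DW` is bounded. [folklore] -/
theorem exists_bound_fderiv_decoyProfile : ∃ M : ℝ, 0 < M ∧ ∀ y, ‖fderiv ℝ decoyProfile y‖ ≤ M := by
  obtain ⟨M, hM⟩ := continuous_fderiv_decoyProfile.bounded_above_of_compact_support
    (hasCompactSupport_decoyProfile.fderiv (𝕜 := ℝ))
  exact ⟨max M 1, by positivity, fun y => (hM y).trans (le_max_left _ _)⟩

/-- Pointwise size of the decoy: `‖u(t,x)‖ ≤ φ(t) a M ≤ a M`. [folklore] -/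
theorem norm_decoy_le {a M : ℝ} (ha : 0 ≤ a) (hM : ∀ y, ‖decoyProfile y‖ ≤ M) (δ t : ℝ)
    (x : EuclideanSpace ℝ (Fin 3)) : ‖decoy a δ t x‖ ≤ decoyTime t * a * M := by
  rw [decoy, norm_smul, Real.norm_of_nonneg (mul_nonneg (decoyTime_nonneg t) ha)]
  exact mul_le_mul_of_nonneg_left (hM _) (mul_nonneg (decoyTime_nonneg t) ha)

/-- **The Type-I rate (H4)**: `‖u(t,x)‖ ≤ C/√(−t)` as soon as `a M ≤ C/2` (`φ` lives where
`−t ≤ 3/2`, so `√(−t) ≤ 2` there). [folklore] -/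
theorem hasTypeITimeDecay_decoy {a C M : ℝ} (ha : 0 ≤ a) (hC : 0 ≤ C) (hM : ∀ y, ‖decoyProfile y‖ ≤ M)
    (haM : a * M ≤ C / 2) (δ : ℝ) : HasTypeITimeDecay C (decoy a δ) := by
  intro t ht x
  have hs : 0 < Real.sqrt (-t) := Real.sqrt_pos.2 (by linarith)
  refine (norm_decoy_le ha hM δ t x).trans ?_
  by_cases hfar : 1 / 2 ≤ |t + 1|
  · rw [decoyTime_eq_zero hfar, zero_mul, zero_mul]
    positivity
  · have ht4 : -t ≤ 4 := by
      rw [not_le] at hfar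
      have := (abs_lt.1 hfar).1
      linarith
    have hsq : Real.sqrt (-t) ≤ 2 := by
      rw [show (2 : ℝ) = Real.sqrt (2 ^ 2) by rw [Real.sqrt_sq (by norm_num : (0:ℝ) ≤ 2)]]
      exact Real.sqrt_le_sqrt (by linarith)
    have hM0 : 0 ≤ M := (norm_nonneg _).trans (hM 0)
    calc decoyTime t * a * M ≤ 1 * a * M :=
          mul_le_mul_of_nonneg_right (mul_le_mul_of_nonneg_right (decoyTime_le_one t) ha) hM0
      _ = a * M := by ring
      _ ≤ C / 2 := haM
      _ ≤ C / Real.sqrt (-t) := div_le_div_of_nonneg_left hC hs hsq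

/-! ### Class-maximality from the class-uniform gauge gradient bound -/

/-- The crux's upper two-frame clause with value `m` holds at `(t, x)`, `t < 0`, for ANY field
whose gauge gradient there is at most `m` in operator norm: `(−t)⟪∇v z, z⟫ ≤ (−t)‖∇v‖ |z|²`
(frame `(e₀, e₁)`). [folklore] -/
theorem upper_clause_of_gauge_norm_le {m t : ℝ} (ht : t < 0)
    {v' : ℝ → EuclideanSpace ℝ (Fin 3) → EuclideanSpace ℝ (Fin 3)} {x : EuclideanSpace ℝ (Fin 3)}
    (hK : (-t) * ‖fderiv ℝ (v' t) x‖ ≤ m) :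
    ∃ v w : EuclideanSpace ℝ (Fin 3), ‖v‖ = 1 ∧ ‖w‖ = 1 ∧ inner ℝ v w = 0 ∧ ∀ α β : ℝ,
      (-t) * inner ℝ (fderiv ℝ (v' t) x (α • v + β • w)) (α • v + β • w) ≤ m * (α ^ 2 + β ^ 2) := by
  refine ⟨kE 0, kE 1, norm_kE 0, norm_kE 1, by simp, fun α β => ?_⟩
  set z : EuclideanSpace ℝ (Fin 3) := α • kE 0 + β • kE 1 with hz
  have hzn : ‖z‖ ^ 2 = α ^ 2 + β ^ 2 := norm_sq_smul_add_smul (norm_kE 0) (norm_kE 1) (by simp) α β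
  have ht' : 0 ≤ -t := by linarith
  have h1 : inner ℝ (fderiv ℝ (v' t) x z) z ≤ ‖fderiv ℝ (v' t) x‖ * ‖z‖ ^ 2 :=
    calc inner ℝ (fderiv ℝ (v' t) x z) z ≤ ‖fderiv ℝ (v' t) x z‖ * ‖z‖ := real_inner_le_norm _ _
      _ ≤ ‖fderiv ℝ (v' t) x‖ * ‖z‖ * ‖z‖ :=
          mul_le_mul_of_nonneg_right (ContinuousLinearMap.le_opNorm _ _) (norm_nonneg _)
      _ = ‖fderiv ℝ (v' t) x‖ * ‖z‖ ^ 2 := by ring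
  calc (-t) * inner ℝ (fderiv ℝ (v' t) x z) z ≤ (-t) * (‖fderiv ℝ (v' t) x‖ * ‖z‖ ^ 2) :=
        mul_le_mul_of_nonneg_left h1 ht'
    _ = ((-t) * ‖fderiv ℝ (v' t) x‖) * ‖z‖ ^ 2 := by ring
    _ ≤ m * ‖z‖ ^ 2 := mul_le_mul_of_nonneg_right hK (sq_nonneg _)
    _ = m * (α ^ 2 + β ^ 2) := by rw [hzn]

/-- **Class-maximality is cheap for large values**: by the class-uniform gauge gradient bound
`(−t)‖∇v(t,x)‖ ≤ K₀(C)` on the Type-I KNSS-mild class (tree `exists_gauge_norm_fderiv_le_of_typeI`,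
KNSS 2009 Prop. 4.1), every `m ≥ K₀(C)` satisfies the crux's class-maximality clause over `𝒦_C`
verbatim (the energy clause of the class is not needed). [cite: KochNadirashviliSereginSverak2009, Prop. 4.1 (4.6)/(4.10), k = 1 (arXiv:0709.3599 p. 8)] -/
theorem exists_isClassMax_of_le (C : ℝ) : ∃ K₀ : ℝ, ∀ m : ℝ, K₀ ≤ m →
    ∀ v' : ℝ → EuclideanSpace ℝ (Fin 3) → EuclideanSpace ℝ (Fin 3), (ContDiffOn ℝ (⊤ : ℕ∞) (Function.uncurry v') (Set.Iio 0 ×ˢ Set.univ) ∧ (∀ t < 0, Literature.Analysis.FluidPDE.VectorCalculus.IsDivFree (v' t)) ∧ (∀ s t : ℝ, s < t → t < 0 → ∀ x, v' t x = Literature.Analysis.FluidPDE.heatFlow (v' s) (t-s) x - ∫ τ in Set.Ioo s t, ∫ y, ((-(inner ℝ (x-y) (v' τ y) / (2*(t-τ)) * Literature.Analysis.UnboundedOperators.heatKernel (t-τ) (x-y))) • v' τ y + (∫ σ in Set.Ioi (t-τ), Literature.Analysis.UnboundedOperators.heatKernel σ (x-y) / (4*σ^2)) • (inner ℝ (x-y)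 (v' τ y) • v' τ y + inner ℝ (v' τ y) (v' τ y) • (x-y) + inner ℝ (x-y) (v' τ y) • v' τ y) - ((∫ σ in Set.Ioi (t-τ), Literature.Analysis.UnboundedOperators.heatKernel σ (x-y) / (8*σ^3)) * (inner ℝ (x-y) (v' τ y) * inner ℝ (x-y) (v' τ y))) • (x-y))) ∧ Literature.Analysis.FluidPDE.HasTypeITimeDecay C v' ∧ (∀ (x₀ : EuclideanSpace ℝ (Fin 3)) (t₀ r : ℝ), t₀ ≤ 0 → 0 < r → (∀ t, t₀ - r^2 < t → t < t₀ → r⁻¹ * ∫ x in Metric.ball x₀ r, ‖v' t x‖^2 ≤ C) ∧ r⁻¹ * ∫ t in Set.Ioo (t₀ - r^2) t₀, ∫ x in Metric.ball x₀ r, ‖fderiv ℝ (v' t) x‖^2 ≤ C)) → ∀ t < 0, ∀ x, (∃ v w : EuclideanSpace ℝ (Fin 3), ‖v‖ = 1 ∧ ‖w‖ = 1 ∧ inner ℝ v w = 0 ∧ ∀ α β : ℝ, (-t) * inner ℝ (fderiv ℝ (v' t) x (α • v + β • w)) (α • v + β • w) ≤ m * (α^2 + β^2)) := by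
  obtain ⟨K₀, hK₀⟩ := exists_gauge_norm_fderiv_le_of_typeI C
  refine ⟨K₀, fun m hm v' hv' t ht x => ?_⟩
  obtain ⟨h1, h2, h3, h4, -⟩ := hv'
  have hv : IsTypeIAncientMild C v' := isTypeIAncientMild_of_squeezeClass h1 h2 h3 h4
  exact upper_clause_of_gauge_norm_le ht ((hK₀ hv t ht x).trans hm)


end Summit.NavierStokesRegularity.NavierStokesRegularity.Theorems.ExtremalBiaxialitySubcritical.Negative

end
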